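import Summits.BirchSwinnertonDyer.BirchSwinnertonDyer.Theorems.AdditiveKolyvaginRoadLevelKolyvaginSystemsAdditiveOnGoodAvatarLocusOfPublished
import HarnessLib

/-!
# Route `AdditiveKolyvaginRoad`, cruxes KS′ `LevelKolyvaginSystemsAdditive` (item stmt-BirchSwinnertonDyer-21396) and
# KPA′ `KolyvaginPrimitiveAdditive` (item stmt-BirchSwinnertonDyer-21400):
# BOTH CRUXES ARE THEIR RESTRICTION TO THE FRAMES OFF THE SLIM GOOD-AVATAR LOCUS, BY NAME
# (cell `pub/bsd-wall`, lead prover `cruxlead-stmt-BirchSwinnertonDyer-21396` g4; `--supports stmt-BirchSwinnertonDyer-21396`, helper;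
# the registered skeleton v12 of line `epsilon_matched_retyping` (`Cruxes/LevelKolyvaginSystemsAdditive/Lines/epsilon_matched_retyping.lean`,
# sha16 31a1d0c9a47cd08f) as FOUR SORRY-FREE CONDITIONAL THEOREMS: its composition `LevelKolyvaginSystemsAdditive_of` with the one research stub
# S1″ `stub_kolyvaginPrimitiveOffGoodAvatarLocusSlim` DISPLAYED as a hypothesis, and its two bookkeeping lemmas, read at the route level)

WHY. After the capstone `PUB → DUAL → (KS′ ↔ KPA′)` (p629856, `levelKolyvaginSystemsAdditive_iff_kolyvaginPrimitiveAdditive_of_published`) and the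
on-locus theorem `levelKolyvaginSystemsAdditive_onGoodAvatarLocus_of_published` (p631381: KS′-fibre on the slim good-avatar locus from Kriz–Li 1.16 +
PUB + DUAL), the registered skeleton closes KS′ from ONE research stub: the conclusion of KPA′ at the ♯ frames OFF the slim good-avatar locus.  THIS FILE
records that reading in the tree, so that the planners re-typing 21396 ∕ 21400 can cite it BY NAME instead of a skeleton: the residual research content
of BOTH cruxes of the Kolyvagin column of `AdditiveKolyvaginRoad` is ONE displayed statement, `OffLocusKPA′` below (spelled out in binders; no
definition is introduced), and it is EXACT.

THE SLIM GOOD-AVATAR LOCUS (verbatim the locus of p631381 ∕ p626643 §3 ∕ skeleton v10–v12): the frame `(E = W, p, K, Dt, β, ι)` carries a rational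
avatar `E₀ = W₀` — globally minimal, a `Γ_ℚ`-equivariant `E[p] ≃ E₀[p]`, GOOD NON-ANOMALOUS at `p`, ♠(1) for `E₀`, `rad(pN) = rad(pN₀)`, the same
multiplicative primes, Heegner for `N₀`, a parametrisation `Dt₀` with `p ∤ c(Dt₀)` — and the LOG CERTIFICATE at `p` («some Heegner point `y₀` of `E₀`
over `heegnerPointComplex Dt₀ H₀` is not `p`-divisible in `E₀(ℚ_p)` along some `ιp : K →+* ℚ_p`»).

WHAT (all CONDITIONAL on the displayed named inputs; `OffLocusKPA′` := «at every ♯ rank-one additive frame of the route OFF the slim good-avatar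
locus, some Kolyvagin–Heegner datum of Kolyvagin-prime support has `c(1) ≠ 0` in `H¹(K, E[p])`», i.e. `KolyvaginPrimitiveAdditive` with the extra
hypothesis «¬ locus»):
* `kolyvaginPrimitiveAdditive_iff_offGoodAvatarLocus_of_thm116` — **`KrizLi 1.16 → (KPA′ ↔ OffLocusKPA′)`**: on the locus KPA′'s conclusion is
  Kriz–Li's transfer at conductor one (`kolyvaginPrimitiveAdditive_conclusion_on_gammaLocus`, sign agreement at the multiplicative primes being automatic
  by `sign_agreement_of_torsionCongr`); off it, it is the hypothesis.  NO PUB ∕ DUAL here.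
* `levelKolyvaginSystemsAdditive_of_published_of_offGoodAvatarLocus` — **`KrizLi 1.16 → PUB → DUAL → OffLocusKPA′ → KS′`** (= the skeleton's
  `LevelKolyvaginSystemsAdditive_of` with S1″ displayed: off the locus the lead's frame-wise socket
  `nonempty_levelKolyvaginSystemP_of_kolyvaginClass_ne_zero_of_published`, on it p631381).
* `offGoodAvatarLocus_of_published_of_levelKolyvaginSystemsAdditive` — **`PUB → DUAL → KS′ → OffLocusKPA′`** (exactness: the tree's BOT′-free converse
  `kolyvaginPrimitiveAdditive_of_published_of_levelSystems`, then restriction).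
* `levelKolyvaginSystemsAdditive_iff_offGoodAvatarLocus_of_published` — **`KrizLi 1.16 → PUB → DUAL → (KS′ ↔ OffLocusKPA′)`**.

HONEST FRAMING: four theorems; 0 definitions, 0 named facts introduced, 0 `sorry`; everything is CONDITIONAL on the displayed named inputs
(`KrizLi2019.thm116_padicLogHeegner_congruence`, `PublishedInputsAdditiveKoly`, `PublishedDualityInputsAdditiveKoly`) and, for the two `_of_` theorems
concluding a crux, on the displayed research statement `OffLocusKPA′` — Kolyvagin's conjecture mod `p` at an additive prime `p ≥ 5` off the avatar
cells, OPEN (in print only for `p ∤ N`).  Closes nothing; a by-name certificate of what the two cruxes still need.  BSD is not proved by any of this;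
KS′ and KPA′ remain OPEN; no summit statement is proved by this file.

References: [cite: KrizLi2019, Thm. 1.16, Rem. 1.17] [cite: WZhang2014, Thm. 1.1, Thm. 4.3, Thm. 7.2, §8.1, Thm. 9.1, §9] [cite: Howard2004HeegnerKolyvagin,
Lemma 2.5.3, Lemma 2.6.4] [cite: McCallumLMS1991, Cor. 3.2] [cite: GrossLMS1991, §4 (4.4)] [cite: DarmonDiamondTaylor1995, Prop. 2.12 (c)].
-/

set_option linter.dupNamespace false -- single-conjunct summit repeats the name by design

noncomputable section

open scoped Classical

namespace Summit.BirchSwinnertonDyer.BirchSwinnertonDyer.Theorems.AdditiveKoly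

open WeierstrassCurve NumberField IsDedekindDomain Field
  Literature.NumberTheory.EllipticCurves Literature.NumberTheory.EllipticCurves.ModularForms
  Literature.NumberTheory.EllipticCurves.Rank1Residual Literature.NumberTheory.GaloisRepresentations Module
  Summit.BirchSwinnertonDyer.Rank1Residual.X11b.Three.Koly
  Summit.BirchSwinnertonDyer.BirchSwinnertonDyer.Theses.AdditiveKolyvaginRoad
  Summit.BirchSwinnertonDyer.Rank1Residual

/-! ## §1 Crux r2 KPA′ is its off-locus restriction, modulo Kriz–Li Thm. 1.16 alone -/

/-- **`KrizLi 1.16 → (KolyvaginPrimitiveAdditive ↔ OffLocusKPA′)`.** `OffLocusKPA′` (the right-hand side, spelled out) is crux r2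
`KolyvaginPrimitiveAdditive` of route `AdditiveKolyvaginRoad` with ONE extra hypothesis at each frame: the frame is OFF the slim good-avatar locus (no
globally minimal `E₀` with a `Γ_ℚ`-equivariant `E[p] ≃ E₀[p]`, good non-anomalous at `p`, ♠(1), `rad(pN) = rad(pN₀)`, same multiplicative primes,
Heegner for `N₀`, `p ∤ c(Dt₀)`, carrying the log certificate at `p`).  (→) restriction.  (←) off the locus the hypothesis; ON the locus the conclusion of
KPA′ is Kriz–Li's transfer of the log certificate at conductor one, `kolyvaginPrimitiveAdditive_conclusion_on_gammaLocus`, whose sign-agreement clause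
at the multiplicative primes is automatic (`sign_agreement_of_torsionCongr`: Tate curve + the torsion congruence, `ℓ ≠ p` as `E` is additive at `p`).
So the research content of crux r2 (item stmt-BirchSwinnertonDyer-21400) is exactly `OffLocusKPA′`, granted the refereed Kriz–Li Thm. 1.16; no PUB ∕ DUAL
is used.  CONDITIONAL on the displayed named input. [cite: KrizLi2019, Thm. 1.16, Rem. 1.17] [cite: GrossLMS1991, §4 (4.4)]
[cite: DarmonDiamondTaylor1995, Prop. 2.12 (c)] -/
theorem kolyvaginPrimitiveAdditive_iff_offGoodAvatarLocus_of_thm116 (hKL : KrizLi2019.thm116_padicLogHeegner_congruence) :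
    KolyvaginPrimitiveAdditive ↔
    (∀ (W : WeierstrassCurve ℚ) [W.IsElliptic] [W.IsGloballyMinimal] [NeZero (W.conductorNorm ℤ)]
      (p : ℕ) [Fact p.Prime] (K : Type) [Field K] [NumberField K]
      (Dt : ModularParametrizationData W (W.conductorNorm ℤ)) (β : ℤ) (ι : K →+* ℂ),
      5 ≤ p → Addv W p → W.HasSurjectiveModNGaloisRep p →
      (∀ (ℓ : ℕ) [Fact ℓ.Prime], W.HasMultiplicativeReductionAtPrime ℓ → ¬ p ∣ padicValInt ℓ W.minimalDiscriminantInt) →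
      (∃ (ℓ₁ ℓ₂ : ℕ) (_ : Fact ℓ₁.Prime) (_ : Fact ℓ₂.Prime), ℓ₁ ≠ ℓ₂ ∧
        W.HasMultiplicativeReductionAtPrime ℓ₁ ∧ W.HasMultiplicativeReductionAtPrime ℓ₂) →
      ¬ p ∣ W.tamagawaProduct → W.analyticRank = 1 → IsImaginaryQuadratic K → Odd (NumberField.discr K) →
      NumberField.discr K < -4 → SatisfiesHeegnerHypothesis (W.conductorNorm ℤ) K →
      (W.quadraticTwist (NumberField.discr K : ℚ)).entireLFunction 1 ≠ 0 →
      (4 * (W.conductorNorm ℤ : ℤ)) ∣ β ^ 2 - NumberField.discr K → ¬ (p : ℤ) ∣ Dt.c →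
      ¬ (∃ (W₀ : WeierstrassCurve ℚ) (_ : W₀.IsElliptic) (_ : W₀.IsGloballyMinimal) (_ : NeZero (W₀.conductorNorm ℤ))
        (Dt₀ : ModularParametrizationData W₀ (W₀.conductorNorm ℤ)) (e : geomTorsion W (p : ℤ) ≃+ geomTorsion W₀ (p : ℤ)),
        (∀ (σ : absoluteGaloisGroup ℚ) (P : geomTorsion W (p : ℤ)), e (σ • P) = σ • e P) ∧
        W₀.HasGoodReductionAtPrime p ∧ ¬ (p : ℤ) ∣ W₀.frobeniusTrace p - 1 ∧
        (∀ (ℓ : ℕ) [Fact ℓ.Prime], W₀.HasMultiplicativeReductionAtPrime ℓ →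
          ¬ p ∣ padicValInt ℓ W₀.minimalDiscriminantInt) ∧
        (∀ q : ℕ, q.Prime → (q ∣ p * W.conductorNorm ℤ ↔ q ∣ p * W₀.conductorNorm ℤ)) ∧
        (∀ (ℓ : ℕ) [Fact ℓ.Prime], W.HasMultiplicativeReductionAtPrime ℓ ↔ W₀.HasMultiplicativeReductionAtPrime ℓ) ∧
        SatisfiesHeegnerHypothesis (W₀.conductorNorm ℤ) K ∧ ¬ (p : ℤ) ∣ Dt₀.c ∧
        ∃ (ιp : K →+* ℚ_[p]) (H₀ : HeegnerDatum (W₀.conductorNorm ℤ) (NumberField.discr K))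
          (y₀ : (W₀.baseChange K).toAffine.Point),
          WeierstrassCurve.Affine.Point.map ι.toRatAlgHom y₀ = heegnerPointComplex Dt₀ H₀ ∧
            ¬ ∃ Q : (W₀.baseChange ℚ_[p]).toAffine.Point, (p : ℤ) • Q = X11b.padicPointOf W₀ p ιp y₀) →
      ∃ (n : ℕ) (d : KolyvaginHeegnerData Dt β ι n),
        KolyvaginDescent.KolSupp (Zhang2014.IsKolyvaginPrime (W.conductorNorm ℤ) W K p) n ∧
          d.kolyvaginClass (Fact.out : p.Prime) 1 ≠ 0) := by
  constructor
  · -- restriction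
    intro hKPA W _ _ _ p _ K _ _ Dt β ι hp hadd hs hsp htwo htam hr hK hodd hlt hH hL hβ hc _
    exact hKPA W p K Dt β ι hp hadd hs hsp htwo htam hr hK hodd hlt hH hL hβ hc
  · -- off the locus: the hypothesis; on the locus: Kriz–Li at conductor one
    intro hOff W _ _ _ p _ K _ _ Dt β ι hp hadd hs hsp htwo htam hr hK hodd hlt hH hL hβ hc
    by_cases hav : (∃ (W₀ : WeierstrassCurve ℚ) (_ : W₀.IsElliptic) (_ : W₀.IsGloballyMinimal) (_ : NeZero (W₀.conductorNorm ℤ))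
        (Dt₀ : ModularParametrizationData W₀ (W₀.conductorNorm ℤ)) (e : geomTorsion W (p : ℤ) ≃+ geomTorsion W₀ (p : ℤ)),
        (∀ (σ : absoluteGaloisGroup ℚ) (P : geomTorsion W (p : ℤ)), e (σ • P) = σ • e P) ∧
        W₀.HasGoodReductionAtPrime p ∧ ¬ (p : ℤ) ∣ W₀.frobeniusTrace p - 1 ∧
        (∀ (ℓ : ℕ) [Fact ℓ.Prime], W₀.HasMultiplicativeReductionAtPrime ℓ →
          ¬ p ∣ padicValInt ℓ W₀.minimalDiscriminantInt) ∧
        (∀ q : ℕ, q.Prime → (q ∣ p * W.conductorNorm ℤ ↔ q ∣ p * W₀.conductorNorm ℤ)) ∧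
        (∀ (ℓ : ℕ) [Fact ℓ.Prime], W.HasMultiplicativeReductionAtPrime ℓ ↔ W₀.HasMultiplicativeReductionAtPrime ℓ) ∧
        SatisfiesHeegnerHypothesis (W₀.conductorNorm ℤ) K ∧ ¬ (p : ℤ) ∣ Dt₀.c ∧
        ∃ (ιp : K →+* ℚ_[p]) (H₀ : HeegnerDatum (W₀.conductorNorm ℤ) (NumberField.discr K))
          (y₀ : (W₀.baseChange K).toAffine.Point),
          WeierstrassCurve.Affine.Point.map ι.toRatAlgHom y₀ = heegnerPointComplex Dt₀ H₀ ∧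
            ¬ ∃ Q : (W₀.baseChange ℚ_[p]).toAffine.Point, (p : ℤ) • Q = X11b.padicPointOf W₀ p ιp y₀)
    · obtain ⟨W₀, _, _, _, Dt₀, e, he, hgood₀, hna, hsp₀, hrad, htype, hH₀, hc₀, ιp, hcert⟩ := hav
      -- sign agreement at the multiplicative primes is automatic (Tate curve + torsion congruence)
      have hsign : ∀ (ℓ : ℕ) [Fact ℓ.Prime], W₀.HasMultiplicativeReductionAtPrime ℓ → W.LFunction ℓ = W₀.LFunction ℓ :=
        sign_agreement_of_torsionCongr W W₀ p hp hadd hsp₀ htype e he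
      exact kolyvaginPrimitiveAdditive_conclusion_on_gammaLocus W p K Dt β ι hKL hp hadd hs hK hlt hH hβ hc
        W₀ e he hgood₀ hna hrad htype hsign Dt₀ hc₀ hH₀ ιp hcert
    · exact hOff W p K Dt β ι hp hadd hs hsp htwo htam hr hK hodd hlt hH hL hβ hc hav

/-! ## §2 Crux r8 KS′ from the off-locus restriction of KPA′ (Kriz–Li 1.16, PUB, DUAL) -/

/-- **`KrizLi 1.16 → PUB → DUAL → OffLocusKPA′ → LevelKolyvaginSystemsAdditive`** — the registered skeleton's composition
`LevelKolyvaginSystemsAdditive_of` (line `epsilon_matched_retyping`, v12) with its one research stub S1″ DISPLAYED as the hypothesis `hOff`.  At a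
♯ frame: off the slim good-avatar locus, `hOff` is a non-zero Kolyvagin class mod `p`, fed to the frame-wise socket
`nonempty_levelKolyvaginSystemP_of_kolyvaginClass_ne_zero_of_published` (mixed Selmer spaces, twin dichotomy from Poitou–Tate, odd bottom rank from
PUB + Cassels–Tate); on it, `levelKolyvaginSystemsAdditive_onGoodAvatarLocus_of_published` (seed by Kriz–Li).  CONDITIONAL on the three named inputs and
on the displayed research statement `hOff` (Kolyvagin's conjecture mod `p` at an additive prime off the avatar cells — OPEN).
[cite: WZhang2014, Thm. 4.3, Thm. 7.2, §8.1, §9] [cite: KrizLi2019, Thm. 1.16] [cite: Howard2004HeegnerKolyvagin, Lemma 2.5.3, Lemma 2.6.4]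
[cite: McCallumLMS1991, Cor. 3.2] -/
theorem levelKolyvaginSystemsAdditive_of_published_of_offGoodAvatarLocus (hKL : KrizLi2019.thm116_padicLogHeegner_congruence)
    (hPUB : PublishedInputsAdditiveKoly) (hDual : PublishedDualityInputsAdditiveKoly)
    (hOff : ∀ (W : WeierstrassCurve ℚ) [W.IsElliptic] [W.IsGloballyMinimal] [NeZero (W.conductorNorm ℤ)]
      (p : ℕ) [Fact p.Prime] (K : Type) [Field K] [NumberField K]
      (Dt : ModularParametrizationData W (W.conductorNorm ℤ)) (β : ℤ) (ι : K →+* ℂ),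
      5 ≤ p → Addv W p → W.HasSurjectiveModNGaloisRep p →
      (∀ (ℓ : ℕ) [Fact ℓ.Prime], W.HasMultiplicativeReductionAtPrime ℓ → ¬ p ∣ padicValInt ℓ W.minimalDiscriminantInt) →
      (∃ (ℓ₁ ℓ₂ : ℕ) (_ : Fact ℓ₁.Prime) (_ : Fact ℓ₂.Prime), ℓ₁ ≠ ℓ₂ ∧
        W.HasMultiplicativeReductionAtPrime ℓ₁ ∧ W.HasMultiplicativeReductionAtPrime ℓ₂) →
      ¬ p ∣ W.tamagawaProduct → W.analyticRank = 1 → IsImaginaryQuadratic K → Odd (NumberField.discr K) →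
      NumberField.discr K < -4 → SatisfiesHeegnerHypothesis (W.conductorNorm ℤ) K →
      (W.quadraticTwist (NumberField.discr K : ℚ)).entireLFunction 1 ≠ 0 →
      (4 * (W.conductorNorm ℤ : ℤ)) ∣ β ^ 2 - NumberField.discr K → ¬ (p : ℤ) ∣ Dt.c →
      ¬ (∃ (W₀ : WeierstrassCurve ℚ) (_ : W₀.IsElliptic) (_ : W₀.IsGloballyMinimal) (_ : NeZero (W₀.conductorNorm ℤ))
        (Dt₀ : ModularParametrizationData W₀ (W₀.conductorNorm ℤ)) (e : geomTorsion W (p : ℤ) ≃+ geomTorsion W₀ (p : ℤ)),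
        (∀ (σ : absoluteGaloisGroup ℚ) (P : geomTorsion W (p : ℤ)), e (σ • P) = σ • e P) ∧
        W₀.HasGoodReductionAtPrime p ∧ ¬ (p : ℤ) ∣ W₀.frobeniusTrace p - 1 ∧
        (∀ (ℓ : ℕ) [Fact ℓ.Prime], W₀.HasMultiplicativeReductionAtPrime ℓ →
          ¬ p ∣ padicValInt ℓ W₀.minimalDiscriminantInt) ∧
        (∀ q : ℕ, q.Prime → (q ∣ p * W.conductorNorm ℤ ↔ q ∣ p * W₀.conductorNorm ℤ)) ∧
        (∀ (ℓ : ℕ) [Fact ℓ.Prime], W.HasMultiplicativeReductionAtPrime ℓ ↔ W₀.HasMultiplicativeReductionAtPrime ℓ) ∧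
        SatisfiesHeegnerHypothesis (W₀.conductorNorm ℤ) K ∧ ¬ (p : ℤ) ∣ Dt₀.c ∧
        ∃ (ιp : K →+* ℚ_[p]) (H₀ : HeegnerDatum (W₀.conductorNorm ℤ) (NumberField.discr K))
          (y₀ : (W₀.baseChange K).toAffine.Point),
          WeierstrassCurve.Affine.Point.map ι.toRatAlgHom y₀ = heegnerPointComplex Dt₀ H₀ ∧
            ¬ ∃ Q : (W₀.baseChange ℚ_[p]).toAffine.Point, (p : ℤ) • Q = X11b.padicPointOf W₀ p ιp y₀) →
      ∃ (n : ℕ) (d : KolyvaginHeegnerData Dt β ι n),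
        KolyvaginDescent.KolSupp (Zhang2014.IsKolyvaginPrime (W.conductorNorm ℤ) W K p) n ∧
          d.kolyvaginClass (Fact.out : p.Prime) 1 ≠ 0) :
    LevelKolyvaginSystemsAdditive :=
  levelKolyvaginSystemsAdditive_of_kolyvaginPrimitiveAdditive_of_published hPUB hDual
    ((kolyvaginPrimitiveAdditive_iff_offGoodAvatarLocus_of_thm116 hKL).mpr hOff)

/-- **`PUB → DUAL → LevelKolyvaginSystemsAdditive → OffLocusKPA′`** — exactness of the residual: KS′ gives KPA′ by the tree's BOT′-free converse
`kolyvaginPrimitiveAdditive_of_published_of_levelSystems` (parity, bottom, rank lowering, local package, Zhang's induction), then restriction to the frames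
off the locus.  So, modulo the named inputs, no residual weaker than `OffLocusKPA′` can close KS′ on this line.  CONDITIONAL on PUB ∕ DUAL.
[cite: WZhang2014, §9 proof of Thm. 9.1, Thm. 9.2, Lemma 5.3, Thm. 7.2, Lemma 8.2] [cite: GrossLMS1991, §4, Prop. 2.3] -/
theorem offGoodAvatarLocus_of_published_of_levelKolyvaginSystemsAdditive (hPUB : PublishedInputsAdditiveKoly)
    (hDual : PublishedDualityInputsAdditiveKoly) (hKS : LevelKolyvaginSystemsAdditive)
    (W : WeierstrassCurve ℚ) [W.IsElliptic] [W.IsGloballyMinimal] [NeZero (W.conductorNorm ℤ)]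
    (p : ℕ) [Fact p.Prime] (K : Type) [Field K] [NumberField K]
    (Dt : ModularParametrizationData W (W.conductorNorm ℤ)) (β : ℤ) (ι : K →+* ℂ) :
    5 ≤ p → Addv W p → W.HasSurjectiveModNGaloisRep p →
    (∀ (ℓ : ℕ) [Fact ℓ.Prime], W.HasMultiplicativeReductionAtPrime ℓ → ¬ p ∣ padicValInt ℓ W.minimalDiscriminantInt) →
    (∃ (ℓ₁ ℓ₂ : ℕ) (_ : Fact ℓ₁.Prime) (_ : Fact ℓ₂.Prime), ℓ₁ ≠ ℓ₂ ∧
      W.HasMultiplicativeReductionAtPrime ℓ₁ ∧ W.HasMultiplicativeReductionAtPrime ℓ₂) →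
    ¬ p ∣ W.tamagawaProduct → W.analyticRank = 1 → IsImaginaryQuadratic K → Odd (NumberField.discr K) →
    NumberField.discr K < -4 → SatisfiesHeegnerHypothesis (W.conductorNorm ℤ) K →
    (W.quadraticTwist (NumberField.discr K : ℚ)).entireLFunction 1 ≠ 0 →
    (4 * (W.conductorNorm ℤ : ℤ)) ∣ β ^ 2 - NumberField.discr K → ¬ (p : ℤ) ∣ Dt.c →
    ¬ (∃ (W₀ : WeierstrassCurve ℚ) (_ : W₀.IsElliptic) (_ : W₀.IsGloballyMinimal) (_ : NeZero (W₀.conductorNorm ℤ))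
      (Dt₀ : ModularParametrizationData W₀ (W₀.conductorNorm ℤ)) (e : geomTorsion W (p : ℤ) ≃+ geomTorsion W₀ (p : ℤ)),
      (∀ (σ : absoluteGaloisGroup ℚ) (P : geomTorsion W (p : ℤ)), e (σ • P) = σ • e P) ∧
      W₀.HasGoodReductionAtPrime p ∧ ¬ (p : ℤ) ∣ W₀.frobeniusTrace p - 1 ∧
      (∀ (ℓ : ℕ) [Fact ℓ.Prime], W₀.HasMultiplicativeReductionAtPrime ℓ →
        ¬ p ∣ padicValInt ℓ W₀.minimalDiscriminantInt) ∧
      (∀ q : ℕ, q.Prime → (q ∣ p * W.conductorNorm ℤ ↔ q ∣ p * W₀.conductorNorm ℤ)) ∧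
      (∀ (ℓ : ℕ) [Fact ℓ.Prime], W.HasMultiplicativeReductionAtPrime ℓ ↔ W₀.HasMultiplicativeReductionAtPrime ℓ) ∧
      SatisfiesHeegnerHypothesis (W₀.conductorNorm ℤ) K ∧ ¬ (p : ℤ) ∣ Dt₀.c ∧
      ∃ (ιp : K →+* ℚ_[p]) (H₀ : HeegnerDatum (W₀.conductorNorm ℤ) (NumberField.discr K))
        (y₀ : (W₀.baseChange K).toAffine.Point),
        WeierstrassCurve.Affine.Point.map ι.toRatAlgHom y₀ = heegnerPointComplex Dt₀ H₀ ∧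
          ¬ ∃ Q : (W₀.baseChange ℚ_[p]).toAffine.Point, (p : ℤ) • Q = X11b.padicPointOf W₀ p ιp y₀) →
    ∃ (n : ℕ) (d : KolyvaginHeegnerData Dt β ι n),
      KolyvaginDescent.KolSupp (Zhang2014.IsKolyvaginPrime (W.conductorNorm ℤ) W K p) n ∧
        d.kolyvaginClass (Fact.out : p.Prime) 1 ≠ 0 := by
  intro hp hadd hs hsp htwo htam hr hK hodd hlt hH hL hβ hc _
  exact kolyvaginPrimitiveAdditive_of_published_of_levelSystems hPUB hDual hKS W p K Dt β ι hp hadd hs hsp htwo htam hr hK hodd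
    hlt hH hL hβ hc

/-- **`KrizLi 1.16 → PUB → DUAL → (LevelKolyvaginSystemsAdditive ↔ OffLocusKPA′)`** — crux r8 KS′ of route `AdditiveKolyvaginRoad` is, modulo the
refereed Kriz–Li Thm. 1.16 and the route's two published bundles, EXACTLY the off-locus restriction of crux r2 KPA′: (→)
`offGoodAvatarLocus_of_published_of_levelKolyvaginSystemsAdditive`; (←) `levelKolyvaginSystemsAdditive_of_published_of_offGoodAvatarLocus`.  Equivalently:
the capstone `KS′ ↔ KPA′` (p629856) composed with §1.  CONDITIONAL on the three named inputs; closes nothing.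
[cite: WZhang2014, Thm. 1.1, Thm. 9.1, §9] [cite: KrizLi2019, Thm. 1.16] -/
theorem levelKolyvaginSystemsAdditive_iff_offGoodAvatarLocus_of_published (hKL : KrizLi2019.thm116_padicLogHeegner_congruence)
    (hPUB : PublishedInputsAdditiveKoly) (hDual : PublishedDualityInputsAdditiveKoly) :
    LevelKolyvaginSystemsAdditive ↔
    (∀ (W : WeierstrassCurve ℚ) [W.IsElliptic] [W.IsGloballyMinimal] [NeZero (W.conductorNorm ℤ)]
      (p : ℕ) [Fact p.Prime] (K : Type) [Field K] [NumberField K]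
      (Dt : ModularParametrizationData W (W.conductorNorm ℤ)) (β : ℤ) (ι : K →+* ℂ),
      5 ≤ p → Addv W p → W.HasSurjectiveModNGaloisRep p →
      (∀ (ℓ : ℕ) [Fact ℓ.Prime], W.HasMultiplicativeReductionAtPrime ℓ → ¬ p ∣ padicValInt ℓ W.minimalDiscriminantInt) →
      (∃ (ℓ₁ ℓ₂ : ℕ) (_ : Fact ℓ₁.Prime) (_ : Fact ℓ₂.Prime), ℓ₁ ≠ ℓ₂ ∧
        W.HasMultiplicativeReductionAtPrime ℓ₁ ∧ W.HasMultiplicativeReductionAtPrime ℓ₂) →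
      ¬ p ∣ W.tamagawaProduct → W.analyticRank = 1 → IsImaginaryQuadratic K → Odd (NumberField.discr K) →
      NumberField.discr K < -4 → SatisfiesHeegnerHypothesis (W.conductorNorm ℤ) K →
      (W.quadraticTwist (NumberField.discr K : ℚ)).entireLFunction 1 ≠ 0 →
      (4 * (W.conductorNorm ℤ : ℤ)) ∣ β ^ 2 - NumberField.discr K → ¬ (p : ℤ) ∣ Dt.c →
      ¬ (∃ (W₀ : WeierstrassCurve ℚ) (_ : W₀.IsElliptic) (_ : W₀.IsGloballyMinimal) (_ : NeZero (W₀.conductorNorm ℤ))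
        (Dt₀ : ModularParametrizationData W₀ (W₀.conductorNorm ℤ)) (e : geomTorsion W (p : ℤ) ≃+ geomTorsion W₀ (p : ℤ)),
        (∀ (σ : absoluteGaloisGroup ℚ) (P : geomTorsion W (p : ℤ)), e (σ • P) = σ • e P) ∧
        W₀.HasGoodReductionAtPrime p ∧ ¬ (p : ℤ) ∣ W₀.frobeniusTrace p - 1 ∧
        (∀ (ℓ : ℕ) [Fact ℓ.Prime], W₀.HasMultiplicativeReductionAtPrime ℓ →
          ¬ p ∣ padicValInt ℓ W₀.minimalDiscriminantInt) ∧
        (∀ q : ℕ, q.Prime → (q ∣ p * W.conductorNorm ℤ ↔ q ∣ p * W₀.conductorNorm ℤ)) ∧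
        (∀ (ℓ : ℕ) [Fact ℓ.Prime], W.HasMultiplicativeReductionAtPrime ℓ ↔ W₀.HasMultiplicativeReductionAtPrime ℓ) ∧
        SatisfiesHeegnerHypothesis (W₀.conductorNorm ℤ) K ∧ ¬ (p : ℤ) ∣ Dt₀.c ∧
        ∃ (ιp : K →+* ℚ_[p]) (H₀ : HeegnerDatum (W₀.conductorNorm ℤ) (NumberField.discr K))
          (y₀ : (W₀.baseChange K).toAffine.Point),
          WeierstrassCurve.Affine.Point.map ι.toRatAlgHom y₀ = heegnerPointComplex Dt₀ H₀ ∧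
            ¬ ∃ Q : (W₀.baseChange ℚ_[p]).toAffine.Point, (p : ℤ) • Q = X11b.padicPointOf W₀ p ιp y₀) →
      ∃ (n : ℕ) (d : KolyvaginHeegnerData Dt β ι n),
        KolyvaginDescent.KolSupp (Zhang2014.IsKolyvaginPrime (W.conductorNorm ℤ) W K p) n ∧
          d.kolyvaginClass (Fact.out : p.Prime) 1 ≠ 0) :=
  (levelKolyvaginSystemsAdditive_iff_kolyvaginPrimitiveAdditive_of_published hPUB hDual).trans
    (kolyvaginPrimitiveAdditive_iff_offGoodAvatarLocus_of_thm116 hKL)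

end Summit.BirchSwinnertonDyer.BirchSwinnertonDyer.Theorems.AdditiveKoly

end
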